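import Summits.AtomisticToContinuum.BoseEinsteinCondensation.Theorems.CorrectorClosure.Negative.InsertionResidueLoadBearing
import Literature.MathematicalPhysics.QuantumManyBody.GroundStateDirichletForm
import Literature.MathematicalPhysics.QuantumManyBody.PeriodicBoseGasLemma33

/-!
# Negative lemmas for crux `CorrectorClosure` (stmt-AtomisticToContinuum-12058), II-a:
plane-wave integrals on the many-body cell

Supports stmt-AtomisticToContinuum-12058 (route `BECInsertionCorrector`); technology for the
refutation `insertionResidue_false_uniformWindow` (file `InsertionResidueUniformWindowFalse`).
Fubini for product integrands on `cellN` (`setIntegral_cellN_prod`), `∫ e_n(xⱼ) dX = 0` and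
plane-wave orthogonality on `cellN`, zero mean and exact norm `∫ |N_k 1|² = M L^{3M}` of the
one-excitation function `N_k 1 = ∑ⱼ e_n(xⱼ)` (`planeWaveSum`), and the exact norm
`(|a|² + M|b|²) L^{3M}` of the affine function `a + b N_k 1` (`lintegral_cellN_nnnorm_sq_affine`).
-/

noncomputable section

open MeasureTheory Filter Metric WithLp
open scoped ENNReal NNReal ComplexConjugate BigOperators

namespace Summit.AtomisticToContinuum.BoseEinsteinCondensation.Theorems.CorrectorClosure.Negative

open Literature.MathematicalPhysics.QuantumManyBody.BoseGas
open Summit.AtomisticToContinuum.BoseEinsteinCondensation.Theses.BECInsertionCorrector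

/-! ## §6 Cell integrals of plane waves over `cellN` (Fubini) -/

section CellNIntegrals

variable {M : ℕ} {L : ℝ}

/-- Fubini on the fundamental cell for product integrands:
`∫_{[0,L)^{3M}} ∏ᵢ fᵢ(xᵢ) dX = ∏ᵢ ∫_{[0,L)³} fᵢ`. [folklore] -/
theorem setIntegral_cellN_prod (L : ℝ) (f : Fin M → Space → ℂ) :
    ∫ X in cellN M L, ∏ i, f i (X i) = ∏ i, ∫ x in cell L, f i x := by
  have h : cellN M L = Set.univ.pi fun _ : Fin M => cell L := by ext X; simp [cellN]
  rw [h, volume_pi, Measure.restrict_pi_pi, integral_fintype_prod_eq_prod]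

/-- `∫_{[0,L)³} c = L³ c`. [folklore] -/
theorem setIntegral_cell_const (hL : 0 ≤ L) (c : ℂ) : ∫ _ in cell L, c = ((L ^ 3 : ℝ) : ℂ) * c := by
  rw [setIntegral_const, Measure.real, volume_cell, ← ENNReal.ofReal_pow hL,
    ENNReal.toReal_ofReal (pow_nonneg hL 3), Complex.real_smul]

/-- `∫_{[0,L)^{3M}} c = L^{3M} c`. [folklore] -/
theorem setIntegral_cellN_const (hL : 0 ≤ L) (c : ℂ) :
    ∫ _ in cellN M L, c = (((L ^ 3) ^ M : ℝ) : ℂ) * c := by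
  rw [setIntegral_const, Measure.real, volume_cellN, ← ENNReal.ofReal_pow hL,
    ← ENNReal.ofReal_pow (pow_nonneg hL 3), ENNReal.toReal_ofReal (by positivity), Complex.real_smul]

/-- `∫_{[0,L)^{3M}} e_n(xⱼ) dX = 0` for `n ≠ 0`. [folklore] -/
theorem setIntegral_cellN_cellWave_apply (hL : 0 < L) {n : Fin 3 → ℤ} (hn : n ≠ 0) (j : Fin M) :
    ∫ X in cellN M L, cellWave L n (X j) = 0 := by
  have h := setIntegral_cellN_prod L (fun i x => if i = j then cellWave L n x else 1)
  simp only [Finset.prod_ite_eq', Finset.mem_univ, if_true] at h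
  rw [h]
  exact Finset.prod_eq_zero (Finset.mem_univ j) (by
    simp only [if_true]
    exact integral_cell_cellWave_eq_zero hL hn)

/-- `∫_{[0,L)^{3M}} e_n(xⱼ) conj(e_n(x_l)) dX = 0` for `j ≠ l`, `n ≠ 0`. [folklore] -/
theorem setIntegral_cellN_cellWave_mul_conj (hL : 0 < L) {n : Fin 3 → ℤ} (hn : n ≠ 0)
    {j l : Fin M} (hjl : j ≠ l) :
    ∫ X in cellN M L, cellWave L n (X j) * conj (cellWave L n (X l)) = 0 := by
  set f : Fin M → Space → ℂ := fun i x =>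
    if i = j then cellWave L n x else if i = l then conj (cellWave L n x) else 1 with hf
  have h : ∀ X : Config M, ∏ i, f i (X i) = cellWave L n (X j) * conj (cellWave L n (X l)) := by
    intro X
    rw [← Finset.mul_prod_erase _ _ (Finset.mem_univ j),
      ← Finset.mul_prod_erase _ _ (Finset.mem_erase.2 ⟨hjl.symm, Finset.mem_univ l⟩)]
    have h1 : f j (X j) = cellWave L n (X j) := by simp [hf]
    have h2 : f l (X l) = conj (cellWave L n (X l)) := by simp [hf, hjl.symm]
    have h3 : ∏ i ∈ (Finset.univ.erase j).erase l, f i (X i) = 1 :=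
      Finset.prod_eq_one fun i hi => by
        simp only [Finset.mem_erase] at hi
        simp [hf, hi.1, hi.2.1]
    rw [h1, h2, h3, mul_one]
  have hint := setIntegral_cellN_prod L f
  simp_rw [h] at hint
  rw [hint]
  exact Finset.prod_eq_zero (Finset.mem_univ j) (by
    simp only [hf, if_true]
    exact integral_cell_cellWave_eq_zero hL hn)

/-- `e_n(xⱼ) conj(e_n(xⱼ)) = 1`. [folklore] -/
theorem cellWave_mul_conj_self (L : ℝ) (n : Fin 3 → ℤ) (x : Space) :
    cellWave L n x * conj (cellWave L n x) = 1 := by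
  rw [Complex.mul_conj', norm_cellWave]
  simp

/-- The one-excitation function `F = N_k 1 = ∑ⱼ e_n(xⱼ)` has zero mean on the cell (`n ≠ 0`).
[folklore] -/
theorem setIntegral_cellN_planeWaveSum (hL : 0 < L) {n : Fin 3 → ℤ} (hn : n ≠ 0) :
    ∫ X in cellN M L, planeWaveSum L n X = 0 := by
  unfold planeWaveSum
  rw [integral_finsetSum _ (f := fun (j : Fin M) (Y : Config M) => cellWave L n (Y j)) (fun j _ =>
    integrableOn_cellN (f := fun Y : Config M => cellWave L n (Y j))
      ((contDiff_cellWave L n).continuous.comp (continuous_apply j)) L)]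
  exact Finset.sum_eq_zero fun j _ => setIntegral_cellN_cellWave_apply hL hn j

/-- `∫_{[0,L)^{3M}} |N_k 1|² = M L^{3M}` (orthogonality of the `M` one-particle excitations).
[folklore] -/
theorem setIntegral_cellN_planeWaveSum_mul_conj (hL : 0 < L) {n : Fin 3 → ℤ} (hn : n ≠ 0) :
    ∫ X in cellN M L, planeWaveSum L n X * conj (planeWaveSum L n X) =
      (M : ℂ) * (((L ^ 3) ^ M : ℝ) : ℂ) := by
  have hcont : ∀ j : Fin M, Continuous fun X : Config M => cellWave L n (X j) := fun j =>
    (contDiff_cellWave L n).continuous.comp (continuous_apply j)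
  have hexp : ∀ X : Config M, planeWaveSum L n X * conj (planeWaveSum L n X) =
      ∑ j, ∑ l, cellWave L n (X j) * conj (cellWave L n (X l)) := by
    intro X
    unfold planeWaveSum
    rw [map_sum, Finset.sum_mul_sum]
  simp_rw [hexp]
  rw [integral_finsetSum _
    (f := fun (j : Fin M) (X : Config M) => ∑ l, cellWave L n (X j) * conj (cellWave L n (X l)))
    (fun j _ => ?_)]
  · have hinner : ∀ j : Fin M, (∫ X in cellN M L, ∑ l, cellWave L n (X j) * conj (cellWave L n (X l)))
        = (((L ^ 3) ^ M : ℝ) : ℂ) := by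
      intro j
      rw [integral_finsetSum _
        (f := fun (l : Fin M) (X : Config M) => cellWave L n (X j) * conj (cellWave L n (X l)))
        (fun l _ => ?_)]
      · rw [Finset.sum_eq_single j]
        · simp_rw [cellWave_mul_conj_self]
          rw [setIntegral_cellN_const hL.le, mul_one]
        · intro l _ hlj
          exact setIntegral_cellN_cellWave_mul_conj hL hn (Ne.symm hlj)
        · intro h; exact (h (Finset.mem_univ j)).elim
      · exact integrableOn_cellN (f := fun X : Config M => cellWave L n (X j) * conj (cellWave L n (X l)))
          ((hcont j).mul (hcont l).star) L
    simp_rw [hinner]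
    rw [Finset.sum_const, Finset.card_univ, Fintype.card_fin, nsmul_eq_mul]
  · exact integrableOn_cellN
      (f := fun X : Config M => ∑ l, cellWave L n (X j) * conj (cellWave L n (X l)))
      (continuous_finsetSum _ fun l _ => (hcont j).mul (hcont l).star) L

/-- **Norm of an affine one-excitation function**: for `G = a + b N_k 1`,
`∫_{[0,L)^{3M}} |G|² = (|a|² + M |b|²) L^{3M}` (as an `ℝ≥0∞` lower integral). [folklore] -/
theorem lintegral_cellN_nnnorm_sq_affine (hL : 0 < L) {n : Fin 3 → ℤ} (hn : n ≠ 0) (a b : ℂ) :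
    ∫⁻ X in cellN M L, (‖a + b * planeWaveSum L n X‖₊ : ℝ≥0∞) ^ 2 =
      ENNReal.ofReal ((‖a‖ ^ 2 + M * ‖b‖ ^ 2) * (L ^ 3) ^ M) := by
  set G : Config M → ℂ := fun X => a + b * planeWaveSum L n X with hG
  have hGc : Continuous G := continuous_const.add (continuous_const.mul (contDiff_planeWaveSum L n).continuous)
  have hFc : Continuous (planeWaveSum (M := M) L n) := (contDiff_planeWaveSum L n).continuous
  -- complex computation of ∫ G conj G
  have hcplx : ∫ X in cellN M L, G X * conj (G X) =
      (((‖a‖ ^ 2 + M * ‖b‖ ^ 2) * (L ^ 3) ^ M : ℝ) : ℂ) := by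
    have hexp : ∀ X, G X * conj (G X) = a * conj a + (a * conj b) * conj (planeWaveSum L n X) +
        (b * conj a) * planeWaveSum L n X +
        (b * conj b) * (planeWaveSum L n X * conj (planeWaveSum L n X)) := by
      intro X; simp only [hG, map_add, map_mul]; ring
    simp_rw [hexp]
    have i1 : IntegrableOn (fun _ : Config M => a * conj a) (cellN M L) volume := integrableOn_cellN continuous_const L
    have i2 : IntegrableOn (fun X : Config M => (a * conj b) * conj (planeWaveSum L n X)) (cellN M L) volume :=
      integrableOn_cellN (continuous_const.mul hFc.star) L
    have i3 : IntegrableOn (fun X : Config M => (b * conj a) * planeWaveSum L n X) (cellN M L) volume :=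
      integrableOn_cellN (continuous_const.mul hFc) L
    have i4 : IntegrableOn (fun X : Config M => (b * conj b) * (planeWaveSum L n X * conj (planeWaveSum L n X))) (cellN M L) volume :=
      integrableOn_cellN (continuous_const.mul (hFc.mul hFc.star)) L
    have i12 : IntegrableOn (fun X : Config M =>
        a * conj a + (a * conj b) * conj (planeWaveSum L n X)) (cellN M L) volume := i1.add i2
    have i123 : IntegrableOn (fun X : Config M =>
        a * conj a + (a * conj b) * conj (planeWaveSum L n X) + (b * conj a) * planeWaveSum L n X)
        (cellN M L) volume := i12.add i3
    have e1 : ∫ _ in cellN M L, a * conj a = (((L ^ 3) ^ M : ℝ) : ℂ) * (a * conj a) :=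
      setIntegral_cellN_const hL.le _
    have e2 : ∫ X in cellN M L, (a * conj b) * conj (planeWaveSum L n X) = 0 := by
      rw [integral_const_mul, integral_conj, setIntegral_cellN_planeWaveSum hL hn, map_zero,
        mul_zero]
    have e3 : ∫ X in cellN M L, (b * conj a) * planeWaveSum L n X = 0 := by
      rw [integral_const_mul, setIntegral_cellN_planeWaveSum hL hn, mul_zero]
    have e4 : ∫ X in cellN M L, (b * conj b) * (planeWaveSum L n X * conj (planeWaveSum L n X)) =
        (b * conj b) * ((M : ℂ) * (((L ^ 3) ^ M : ℝ) : ℂ)) := by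
      rw [integral_const_mul, setIntegral_cellN_planeWaveSum_mul_conj hL hn]
    rw [integral_add i123 i4, integral_add i12 i3, integral_add i1 i2, e1, e2, e3, e4,
      Complex.mul_conj', Complex.mul_conj']
    push_cast
    ring
  -- real integral of ‖G‖²
  have hreal : ∫ X in cellN M L, ‖G X‖ ^ 2 = (‖a‖ ^ 2 + M * ‖b‖ ^ 2) * (L ^ 3) ^ M := by
    have h1 : ((∫ X in cellN M L, ‖G X‖ ^ 2 : ℝ) : ℂ) = ∫ X in cellN M L, G X * conj (G X) := by
      rw [← integral_complex_ofReal]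
      congr 1
      funext X
      rw [Complex.mul_conj']
      push_cast
      rfl
    exact_mod_cast h1.trans hcplx
  have hint : IntegrableOn (fun X => ‖G X‖ ^ 2) (cellN M L) volume :=
    integrableOn_cellN (hGc.norm.pow 2) L
  calc ∫⁻ X in cellN M L, (‖G X‖₊ : ℝ≥0∞) ^ 2
      = ∫⁻ X in cellN M L, ENNReal.ofReal (‖G X‖ ^ 2) := by simp_rw [coe_nnnorm_sq_eq_ofReal]
    _ = ENNReal.ofReal (∫ X in cellN M L, ‖G X‖ ^ 2) :=
        (ofReal_integral_eq_lintegral_ofReal hint (Filter.Eventually.of_forall fun X => by positivity)).symm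
    _ = _ := by rw [hreal]

end CellNIntegrals

end Summit.AtomisticToContinuum.BoseEinsteinCondensation.Theorems.CorrectorClosure.Negative

end
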